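import Summits.BirchSwinnertonDyer.BirchSwinnertonDyer.Theorems.AlignedTransportAtTwoMainConjectureOfRankZeroBSDAtTwoHalfDescentBaseIndex
import Summits.BirchSwinnertonDyer.BirchSwinnertonDyer.Theorems.AlignedTransportAtTwoMainConjectureOfRankZeroBSDAtTwoHalfDescentLayerIndexSelmer
import Literature.NumberTheory.EllipticCurves.IwasawaSelmerControlExactCountProofs
import HarnessLib

/-!
# Route `AlignedTransportAtTwo`, crux C2 `MainConjectureOfRankZeroBSDAtTwo` (stmt-BirchSwinnertonDyer-22298):
# THE BASE TERM CARRIES `p^μ`, III — SELMER CURRENCY AND THE `γ`-FREE DOOR: for EVERY elliptic curve over EVERY number field, EVERY prime, EVERY `ℤ_p`-extension,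
# every Pontryagin-dual datum with `X` finitely generated torsion and EVERY layer `n`: `p^{pⁿ·μ} ∣ #Sel_{p^∞}(E/K_∞)^{Γ_n}` and `p^{pⁿ·μ} ∣ #Sel_{p^∞}(E/K_n) · #ker g_n`;
# hence `0 < #Sel_{p^∞}(E/K_n)·#ker g_n < p^{pⁿ}` at ANY ONE layer ⟹ `μ(X(E/K_∞)) = 0`, and at the base `p ∤ #Sel_{p^∞}(E/K)·#ker g_0 ⟹ μ = λ = 0`

HONEST FRAMING (cell `bsd-f1-sign2`, WIDTH-5 attached prover seat `bsd-line-att-p5` gen 60 on line `birth` of the lead `bsd-line-att-p2`;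
`--supports` stmt-BirchSwinnertonDyer-22298, closes nothing; BSD is NOT proved by any of this; the crux C2, its verdict «blocked-on
`Rank1Residual.GreenbergMuConjectureIrreducible`» and every registered stub (P / T / Kμ / LimDoor / MuIneqʳ / PFμ⁺) are untouched). THEOREMS ONLY — no `def`,
no instance, no named fact, no `sorry`. Route-independent (no Theses import). Sequel of this gen's `…HalfDescentBaseIndex` (`p^{pⁿ·μ(X)} ∣ #(X/ω_nX)` for every f.g. torsion
`Λ`-module; `#(X/TX) = p^{ord_p f(0)}·#(F/TF)`; `p ∤ #(X/TX) ⟹ μ = λ = 0`) read through gen 54's Pontryagin identification `#(X/ω_nX) = #Sel_{p^∞}(E/K_∞)^{Γ_n}`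
(`…LayerIndexSelmer`) and Greenberg's Lemma 4.3 in the tree's unconditional `Nat.card` form `#Sel_∞^{Γ_n} · #ker h_n = #Sel_{p^∞}(E/K_n) · #ker g_n`
(`WeierstrassCurve.natCard_selmerInvariants_mul_natCard_ker_layerToInfty`; `h_n : H¹(K_n, E[p^∞]) → H¹(K_∞, E[p^∞])`, `ker g_n = A_n/Sel_n` Greenberg's control kernel).
The restriction kernel `ker h_n` is ELIMINATED by a case split (`#ker h_n = 0` makes the right side `0`; otherwise a divisor of `#Sel_∞^{Γ_n}` divides `#Sel_∞^{Γ_n}·#ker h_n`),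
so NO hypothesis on `E(K)[p]`, on the reduction type, on `κ` or on the rank survives.

THE POINT (`E/K` elliptic over a number field, `p` any prime, `κ` any `ℤ_p`-extension with topological generator `γ`, `D` any Pontryagin-dual datum with `X = D.X` f.g. torsion):
* §1 ★★★ `pow_mul_mu_dvd_natCard_selmerInvariants`: **`p^{pⁿ·μ(X)} ∣ #Sel_{p^∞}(E/K_∞)^{Γ_n}`** for every `n` (g56 had `p^{(pⁿ−1)μ}·#Sel_∞^Γ ∣ #Sel_∞^{Γ_n}`; the base factor
  `#Sel_∞^Γ` is itself divisible by `p^μ`); ★★ `mu_eq_zero_of_natCard_selmerInvariants_pos_lt` (`0 < #Sel_∞^{Γ_n} < p^{pⁿ} ⟹ μ = 0`); the EXACT base count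
  `natCard_selmerInvariants_zero_eq_pow_mul`: **`#Sel_∞^Γ = p^{ord_p f_X(0)} · #(F/TF)`** (`char X = (f_X)`, `f_X(0) ≠ 0`, `F` the largest finite submodule — Greenberg's Lemma 4.2
  «`f_E(0) ∼ #S^Γ/#S_Γ`» in kernel form: `#(F/TF) = #F[T]` is the `#S_Γ` term), and `#Sel_∞^Γ ≠ 0 ⟺ f_X(0) ≠ 0`.
* §2 ★★★ `pow_mul_mu_dvd_natCard_selmerLayer_mul_kerG`: **`p^{pⁿ·μ(X)} ∣ #Sel_{p^∞}(E/K_n) · #ker g_n`** for EVERY `n`, NO further hypothesis; at `n = 0`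
  **`p^{μ} ∣ #Sel_{p^∞}(E/K) · #ker g_0`** — which SUPERSEDES gen 59's `2^{μ₂} ∣ #Sel_{2^∞}(E/ℚ)·#ker g_0(E)·#ker g_1(E)` (`…GrowthFiniteTwistOrbit`: `K = ℚ`, `p = 2`, `κ`
  cyclotomic, `E[2]` irreducible, via the `χ₂`-twist orbit): no second kernel, no twist, any `K`, `p`, `κ`;
  ★★★ **THE `γ`-FREE DOOR `mu_eq_zero_of_natCard_selmerLayer_mul_kerG_pos_lt`: `0 < #Sel_{p^∞}(E/K_n)·#ker g_n < p^{pⁿ}` at ANY ONE layer ⟹ `μ(X(E/K_∞)) = 0`** — only the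
  ORDER of the honest `p^∞`-Selmer group over ONE layer `K_n` and Greenberg's control kernel AT THAT layer: no topological generator, no norm or growth operator, no twist,
  no second layer (gen 57's door `0 < #((γ^{pⁿ}−1)·Sel_{p^∞}(E/K_{n+1}))·#ker g_{n+1} < p^{pⁿ(p−1)}` lives one layer UP); ★★ `pow_mul_mu_le_log`:
  **`pⁿ·μ ≤ log_p(#Sel_{p^∞}(E/K_n)·#ker g_n)`** whenever the product is positive — every layer climbed divides the `μ`-bound by `p`;
  ★★★ **THE BASE DOOR `charIdeal_eq_top_of_not_dvd`: `p ∤ #Sel_{p^∞}(E/K)·#ker g_0 ⟹ char_Λ X(E/K_∞) = Λ`, `μ = 0`, `λ = 0`** (Greenberg's «`f_E(0) ∈ Λˣ`» case in kernel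
  currency: the control kernel replaces the local Euler factors of Thm. 4.1, and no Euler-characteristic formula, no ordinarity, no finiteness of `Ш` is used).
Reading for C2 (`p = 2`, seed cell): `2^{2ⁿ·μ₂} ∣ #Sel_{2^∞}(W/ℚ_n)·#ker g_n(W/ℚ_n)` at every layer `ℚ_n = ℚ(ζ_{2^{n+2}})⁺`; one layer with `#Ш(W/ℚ_n)[2^∞]·#ker g_n < 2^{2ⁿ}` (rank `0` at
that layer) certifies `μ₂ = 0` (sequel `…BaseIndexTwo`: kernels finite positive on the ordinary cell, completeness over `ℚ`). What is NOT claimed: nothing about any curve;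
no Selmer group or kernel computed; C2 untouched. Memo `Cruxes/MainConjectureOfRankZeroBSDAtTwo/BASE-TERM-att-p5-g60.md`.

References: R. Greenberg, LNM 1716 (1999), Thm. 1.10, Conj. 1.11, §3 Lemmas 3.1–3.5 (pp. 85–90), §4 Lemmas 4.2–4.3 (p. 103), p. 104 [GreenbergLNM1716]; B. Mazur, Invent.
Math. 18 (1972) §6 [Mazur1972]; L. Washington, GTM 83, §13.3 Thm. 13.13 [Washington1997]; B. Perrin-Riou, Bull. SMF 115 (1987) §1.
-/

set_option linter.dupNamespace false
set_option autoImplicit false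

noncomputable section

open scoped Classical Polynomial

universe u

namespace Summit.BirchSwinnertonDyer.BirchSwinnertonDyer.Theorems.AlignedTransportAtTwoHalfDescentBaseIndexSelmer

open WeierstrassCurve Literature.NumberTheory.EllipticCurves Literature.NumberTheory.EllipticCurves.IwasawaAlgebra
  Summit.BirchSwinnertonDyer.Rank1Residual.X1.MuLambda
  Summit.BirchSwinnertonDyer.Rank1Residual.X1.ParitySqueeze
  Summit.BirchSwinnertonDyer.Rank1Residual.X1.GeneratorBoundMu
  Summit.BirchSwinnertonDyer.Rank1Residual.Iwasawa
  Summit.BirchSwinnertonDyer.BirchSwinnertonDyer.Theorems.AlignedTransportAtTwoHalfDescentLayerIndexSelmer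
  Summit.BirchSwinnertonDyer.BirchSwinnertonDyer.Theorems.AlignedTransportAtTwoHalfDescentBaseRing
  Summit.BirchSwinnertonDyer.BirchSwinnertonDyer.Theorems.AlignedTransportAtTwoHalfDescentBaseIndex

variable {K : Type u} [Field K] [NumberField K] (W : WeierstrassCurve K) {p : ℕ} [hp : Fact p.Prime] (κ : ZpExtension K p)
  {γ : Field.absoluteGaloisGroup K}

/-! ## §1 The invariants of the limit Selmer group: `p^{pⁿ·μ} ∣ #Sel_{p^∞}(E/K_∞)^{Γ_n}`; the exact base count -/

section Invariants

/-- ★★★ **`p^{pⁿ·μ(X(E/K_∞))} ∣ #Sel_{p^∞}(E/K_∞)^{Γ_n}` for EVERY `n`** — `E/K`, ANY `ℤ_p`-extension `κ` with topological generator `γ`, ANY Pontryagin-dual datum with `X`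
f.g. torsion (`Nat.card`; reads `∣ 0` where the invariants are infinite). [cite: GreenbergLNM1716, Thm. 1.10, Conj. 1.11 and §3 p. 85] [cite: Washington1997, §13.3 Thm. 13.13] -/
theorem pow_mul_mu_dvd_natCard_selmerInvariants (hγ : κ.IsTopGenerator γ) (D : W.SelmerDualData κ γ) [Module.Finite (IwasawaAlgebra p) D.X]
    (hD : D.IsTorsion) (n : ℕ) : p ^ (p ^ n * D.mu) ∣ Nat.card ↥(W.selmerInfty κ ⊓ W.layerInvariants κ n) := by
  rw [← natCard_layerQuotient_omega_eq_natCard_selmerInvariants W κ hγ D n]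
  exact pow_mul_muInvariant_dvd_natCard_quotient_omega (M := D.X) hD n

/-- ★★ At the base: **`p^{μ(X(E/K_∞))} ∣ #Sel_{p^∞}(E/K_∞)^Γ`** (`Γ = Gal(K_∞/K)`). [cite: GreenbergLNM1716, Conj. 1.11 and §4 Lemma 4.2] -/
theorem pow_mu_dvd_natCard_selmerInvariants_zero (hγ : κ.IsTopGenerator γ) (D : W.SelmerDualData κ γ) [Module.Finite (IwasawaAlgebra p) D.X]
    (hD : D.IsTorsion) : p ^ D.mu ∣ Nat.card ↥(W.selmerInfty κ ⊓ W.layerInvariants κ 0) := by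
  have h := pow_mul_mu_dvd_natCard_selmerInvariants W κ hγ D hD 0
  rwa [pow_zero, one_mul] at h

/-- ★★ **`0 < #Sel_{p^∞}(E/K_∞)^{Γ_n} < p^{pⁿ}` at ANY ONE `n` ⟹ `μ(X(E/K_∞)) = 0`** — one group of invariants, no growth, no norm, no `λ`.
[cite: GreenbergLNM1716, Conj. 1.11] [cite: Washington1997, §13.3 Thm. 13.13] -/
theorem mu_eq_zero_of_natCard_selmerInvariants_pos_lt (hγ : κ.IsTopGenerator γ) (D : W.SelmerDualData κ γ) [Module.Finite (IwasawaAlgebra p) D.X]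
    (hD : D.IsTorsion) {n : ℕ} (hpos : 0 < Nat.card ↥(W.selmerInfty κ ⊓ W.layerInvariants κ n))
    (hlt : Nat.card ↥(W.selmerInfty κ ⊓ W.layerInvariants κ n) < p ^ (p ^ n)) : D.mu = 0 := by
  rw [← natCard_layerQuotient_omega_eq_natCard_selmerInvariants W κ hγ D n] at hpos hlt
  exact muInvariant_eq_zero_of_natCard_quotient_omega_pos_lt (M := D.X) hD hpos hlt

/-- ★★ **THE EXACT BASE COUNT `#Sel_{p^∞}(E/K_∞)^Γ = p^{ord_p f_X(0)} · #(F/TF)`** (`char_Λ X = (f_X)`, `f_X(0) ≠ 0`, `F ≤ X` finite with `X/F` free of finite submodules) —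
Greenberg's Lemma 4.2 «`f_E(0) ∼ #S^Γ / #S_Γ`» in kernel form (`#(F/TF) = #F[T]` plays `#S_Γ`). [cite: GreenbergLNM1716, §4 Lemma 4.2 (p. 103)] [cite: Washington1997, §13.3 Thm. 13.13] -/
theorem natCard_selmerInvariants_zero_eq_pow_mul (hγ : κ.IsTopGenerator γ) (D : W.SelmerDualData κ γ) [Module.Finite (IwasawaAlgebra p) D.X] (hD : D.IsTorsion)
    (F : Submodule (IwasawaAlgebra p) D.X) [Finite F] (hF : ∀ N : Submodule (IwasawaAlgebra p) (D.X ⧸ F), Finite N → N = ⊥) {f : IwasawaAlgebra p}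
    (hchar : D.charIdeal = Ideal.span {f}) (h0 : PowerSeries.constantCoeff f ≠ 0) :
    Nat.card ↥(W.selmerInfty κ ⊓ W.layerInvariants κ 0) =
      p ^ (PowerSeries.constantCoeff f).valuation * Nat.card (F ⧸ (Ideal.span {(PowerSeries.X : IwasawaAlgebra p)} • ⊤ : Submodule (IwasawaAlgebra p) F)) := by
  rw [← natCard_layerQuotient_omega_eq_natCard_selmerInvariants W κ hγ D 0, pow_zero, pow_one, add_sub_cancel_left]
  exact natCard_quotient_X_smul_top_eq_pow_mul (M := D.X) hD F hF hchar h0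

/-- `X(E/K_∞)` without non-zero finite submodule: **`#Sel_{p^∞}(E/K_∞)^Γ = p^{ord_p f_X(0)}`** (`f_X(0) ≠ 0`). [cite: GreenbergLNM1716, §4 Lemma 4.2 and Prop. 4.14–4.15] -/
theorem natCard_selmerInvariants_zero_eq_pow (hγ : κ.IsTopGenerator γ) (D : W.SelmerDualData κ γ) [Module.Finite (IwasawaAlgebra p) D.X] (hD : D.IsTorsion)
    (hnf : ∀ N : Submodule (IwasawaAlgebra p) D.X, Finite N → N = ⊥) {f : IwasawaAlgebra p} (hchar : D.charIdeal = Ideal.span {f})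
    (h0 : PowerSeries.constantCoeff f ≠ 0) : Nat.card ↥(W.selmerInfty κ ⊓ W.layerInvariants κ 0) = p ^ (PowerSeries.constantCoeff f).valuation := by
  rw [← natCard_layerQuotient_omega_eq_natCard_selmerInvariants W κ hγ D 0, pow_zero, pow_one, add_sub_cancel_left]
  exact natCard_quotient_X_smul_top_eq_pow (M := D.X) hD hnf hchar h0

/-- **`Sel_{p^∞}(E/K_∞)^Γ` is finite (`Nat.card ≠ 0`) ⟺ `f_X(0) ≠ 0`** (`char_Λ X = (f_X)`; the rank-`0` condition at the base of the tower).
[cite: GreenbergLNM1716, §4 Lemma 4.2 (p. 103)] -/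
theorem natCard_selmerInvariants_zero_ne_zero_iff (hγ : κ.IsTopGenerator γ) (D : W.SelmerDualData κ γ) [Module.Finite (IwasawaAlgebra p) D.X] (hD : D.IsTorsion)
    {f : IwasawaAlgebra p} (hchar : D.charIdeal = Ideal.span {f}) :
    Nat.card ↥(W.selmerInfty κ ⊓ W.layerInvariants κ 0) ≠ 0 ↔ PowerSeries.constantCoeff f ≠ 0 := by
  rw [← natCard_layerQuotient_omega_eq_natCard_selmerInvariants W κ hγ D 0, pow_zero, pow_one, add_sub_cancel_left]
  exact natCard_quotient_X_smul_top_ne_zero_iff (M := D.X) hD hchar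

end Invariants

/-! ## §2 Finite level through Lemma 4.3: `p^{pⁿ·μ} ∣ #Sel_{p^∞}(E/K_n) · #ker g_n`, the `γ`-free door, the base door -/

section Layer

/-- ★★★ **`p^{pⁿ·μ(X(E/K_∞))} ∣ #Sel_{p^∞}(E/K_n) · #ker g_n` for EVERY `n`, with NO further hypothesis** (`E/K`, any `p`, any `ℤ_p`-extension, any dual datum with `X` f.g.
torsion; `ker g_n = A_n/Sel_n` Greenberg's control kernel). Lemma 4.3 `#Sel_∞^{Γ_n}·#ker h_n = #Sel_n·#ker g_n` and §1; the restriction kernel drops out (`#ker h_n = 0` forces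
the right side to vanish). At `n = 0`: `p^{μ} ∣ #Sel_{p^∞}(E/K)·#ker g_0`. [cite: GreenbergLNM1716, §3 Lemmas 3.1–3.2, §4 Lemma 4.3 (p. 103), Conj. 1.11] [cite: Mazur1972, §6] -/
theorem pow_mul_mu_dvd_natCard_selmerLayer_mul_kerG (hγ : κ.IsTopGenerator γ) (D : W.SelmerDualData κ γ) [Module.Finite (IwasawaAlgebra p) D.X]
    (hD : D.IsTorsion) (n : ℕ) : p ^ (p ^ n * D.mu) ∣ Nat.card ↥(W.selmerLayer κ n) * Nat.card (W.KerG κ n) := by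
  have h43 := W.natCard_selmerInvariants_mul_natCard_ker_layerToInfty κ n
  have hdvd := pow_mul_mu_dvd_natCard_selmerInvariants W κ hγ D hD n
  by_cases hh : Nat.card (W.layerToInfty κ n).ker = 0
  · rw [← h43, hh, mul_zero]; exact dvd_zero _
  · rw [← h43]; exact hdvd.mul_right _

/-- ★★★ At the base: **`p^{μ(X(E/K_∞))} ∣ #Sel_{p^∞}(E/K) · #ker g_0(E/K)`** — for EVERY elliptic curve over a number field, every prime, every `ℤ_p`-extension (supersedes
gen 59's three-factor bound over `ℚ` at `2`). [cite: GreenbergLNM1716, Conj. 1.11, §4 Lemmas 4.2–4.3] -/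
theorem pow_mu_dvd_natCard_selmerLayer_zero_mul_kerG_zero (hγ : κ.IsTopGenerator γ) (D : W.SelmerDualData κ γ) [Module.Finite (IwasawaAlgebra p) D.X]
    (hD : D.IsTorsion) : p ^ D.mu ∣ Nat.card ↥(W.selmerLayer κ 0) * Nat.card (W.KerG κ 0) := by
  have h := pow_mul_mu_dvd_natCard_selmerLayer_mul_kerG W κ hγ D hD 0
  rwa [pow_zero, one_mul] at h

/-- ★★★ **THE `γ`-FREE DOOR: `0 < #Sel_{p^∞}(E/K_n) · #ker g_n < p^{pⁿ}` at ANY ONE layer `n` ⟹ `μ(X(E/K_∞)) = 0`.** `E/K` elliptic over a number field, ANY prime `p`, ANY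
`ℤ_p`-extension, ANY Pontryagin-dual datum with `X` f.g. torsion. Inputs: the ORDER of the honest Selmer group `Sel_{p^∞}(E/K_n)` and of Greenberg's control kernel at the SAME
layer — nothing else. [cite: GreenbergLNM1716, Conj. 1.11, §3, §4 Lemma 4.3] [cite: Washington1997, §13.3 Thm. 13.13] -/
theorem mu_eq_zero_of_natCard_selmerLayer_mul_kerG_pos_lt (hγ : κ.IsTopGenerator γ) (D : W.SelmerDualData κ γ) [Module.Finite (IwasawaAlgebra p) D.X]
    (hD : D.IsTorsion) {n : ℕ} (hpos : 0 < Nat.card ↥(W.selmerLayer κ n) * Nat.card (W.KerG κ n))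
    (hlt : Nat.card ↥(W.selmerLayer κ n) * Nat.card (W.KerG κ n) < p ^ (p ^ n)) : D.mu = 0 := by
  have hle := (Nat.le_of_dvd hpos (pow_mul_mu_dvd_natCard_selmerLayer_mul_kerG W κ hγ D hD n)).trans_lt hlt
  have hexp := (Nat.pow_lt_pow_iff_right hp.out.one_lt).mp hle
  by_contra hμ
  have h1 : 1 ≤ D.mu := Nat.one_le_iff_ne_zero.mpr hμ
  have : p ^ n ≤ p ^ n * D.mu := Nat.le_mul_of_pos_right _ h1
  omega

/-- ★★ **THE `μ`-BOUND AT ONE LAYER: `pⁿ · μ(X(E/K_∞)) ≤ log_p(#Sel_{p^∞}(E/K_n) · #ker g_n)`** whenever the product is positive (both finite) — each layer climbed divides the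
bound by `p`. [cite: GreenbergLNM1716, Thm. 1.10, Conj. 1.11, §4 Lemma 4.3] -/
theorem pow_mul_mu_le_log (hγ : κ.IsTopGenerator γ) (D : W.SelmerDualData κ γ) [Module.Finite (IwasawaAlgebra p) D.X] (hD : D.IsTorsion) {n : ℕ}
    (hpos : 0 < Nat.card ↥(W.selmerLayer κ n) * Nat.card (W.KerG κ n)) :
    p ^ n * D.mu ≤ Nat.log p (Nat.card ↥(W.selmerLayer κ n) * Nat.card (W.KerG κ n)) :=
  Nat.le_log_of_pow_le hp.out.one_lt (Nat.le_of_dvd hpos (pow_mul_mu_dvd_natCard_selmerLayer_mul_kerG W κ hγ D hD n))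

/-- At the base: **`μ(X(E/K_∞)) ≤ log_p(#Sel_{p^∞}(E/K) · #ker g_0)`** whenever the product is positive. [cite: GreenbergLNM1716, Conj. 1.11, §4 Thm. 4.1 and Lemma 4.3] -/
theorem mu_le_log_zero (hγ : κ.IsTopGenerator γ) (D : W.SelmerDualData κ γ) [Module.Finite (IwasawaAlgebra p) D.X] (hD : D.IsTorsion)
    (hpos : 0 < Nat.card ↥(W.selmerLayer κ 0) * Nat.card (W.KerG κ 0)) : D.mu ≤ Nat.log p (Nat.card ↥(W.selmerLayer κ 0) * Nat.card (W.KerG κ 0)) := by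
  have h := pow_mul_mu_le_log W κ hγ D hD hpos
  rwa [pow_zero, one_mul] at h

/-- ★★★ **THE BASE DOOR: `p ∤ #Sel_{p^∞}(E/K) · #ker g_0 ⟹ char_Λ X(E/K_∞) = Λ`, `μ = 0` and `λ = 0`** — for EVERY elliptic curve over a number field, every prime, every
`ℤ_p`-extension, every dual datum with `X` f.g. torsion: if the honest Selmer order at the base times Greenberg's base control kernel is prime to `p`, the Iwasawa module has
unit characteristic series (`p ∤ #Sel_∞^Γ = #(X/TX)`, file II). Greenberg's «`f_E(0) ∈ Λˣ`» case, with the control kernel in place of the local Euler factors of Thm. 4.1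
and no Euler-characteristic formula. [cite: GreenbergLNM1716, §4 Thm. 4.1, Lemma 4.3 and p. 104] [cite: Washington1997, §13.2 (Nakayama) and §13.3] -/
theorem charIdeal_eq_top_of_not_dvd (hγ : κ.IsTopGenerator γ) (D : W.SelmerDualData κ γ) [Module.Finite (IwasawaAlgebra p) D.X] (hD : D.IsTorsion)
    (hnd : ¬ p ∣ Nat.card ↥(W.selmerLayer κ 0) * Nat.card (W.KerG κ 0)) : D.charIdeal = ⊤ ∧ D.mu = 0 ∧ D.lambda = 0 := by
  -- the base index `#(X/TX) = #Sel_∞^Γ` is prime to `p`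
  have h43 := W.natCard_selmerInvariants_mul_natCard_ker_layerToInfty κ 0
  have hnd' : ¬ p ∣ Nat.card (D.X ⧸ (Ideal.span {(PowerSeries.X : IwasawaAlgebra p)} • ⊤ : Submodule (IwasawaAlgebra p) D.X)) := by
    have e := natCard_layerQuotient_omega_eq_natCard_selmerInvariants W κ hγ D 0
    rw [pow_zero, pow_one, add_sub_cancel_left] at e
    rw [e]
    intro h
    apply hnd
    rw [← h43]
    exact h.mul_right _
  obtain ⟨f, hf0, hchar⟩ := exists_charGenerator_ne_zero D.X hD
  obtain ⟨hmu, hlam, htop⟩ := mu_eq_zero_and_lam_eq_zero_of_not_dvd (M := D.X) hD hchar hnd'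
  refine ⟨htop, ?_, ?_⟩
  · change muInvariant p D.X = 0
    rw [← Summit.BirchSwinnertonDyer.Rank1Residual.X1.MuPart.mu_generator_eq_muInvariant D.X hD hf0 hchar, hmu]
  · change lambdaInvariant p D.X = 0
    rw [← lam_generator_eq_lambdaInvariant D.X hD hf0 hchar, hlam]

/-- ★★ **THE FINITE-LEVEL BASE COUNT** (Iwasawa's `e_0`, exact): `char_Λ X = (f_X)`, `f_X(0) ≠ 0`, `F` the largest finite submodule:
**`#Sel_{p^∞}(E/K) · #ker g_0 = p^{ord_p f_X(0)} · #(F/TF) · #ker h_0`** (`#ker h_0 = #E(K)[p^∞]`-type torsion kernel, `= 1` when `E(K)[p] = 0`).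
[cite: GreenbergLNM1716, §4 Lemmas 4.2–4.3 (p. 103)] -/
theorem natCard_selmerLayer_zero_mul_kerG_zero_eq (hγ : κ.IsTopGenerator γ) (D : W.SelmerDualData κ γ) [Module.Finite (IwasawaAlgebra p) D.X] (hD : D.IsTorsion)
    (F : Submodule (IwasawaAlgebra p) D.X) [Finite F] (hF : ∀ N : Submodule (IwasawaAlgebra p) (D.X ⧸ F), Finite N → N = ⊥) {f : IwasawaAlgebra p}
    (hchar : D.charIdeal = Ideal.span {f}) (h0 : PowerSeries.constantCoeff f ≠ 0) :
    Nat.card ↥(W.selmerLayer κ 0) * Nat.card (W.KerG κ 0) =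
      p ^ (PowerSeries.constantCoeff f).valuation * Nat.card (F ⧸ (Ideal.span {(PowerSeries.X : IwasawaAlgebra p)} • ⊤ : Submodule (IwasawaAlgebra p) F)) *
        Nat.card (W.layerToInfty κ 0).ker := by
  rw [← W.natCard_selmerInvariants_mul_natCard_ker_layerToInfty κ 0, natCard_selmerInvariants_zero_eq_pow_mul W κ hγ D hD F hF hchar h0]

end Layer

end Summit.BirchSwinnertonDyer.BirchSwinnertonDyer.Theorems.AlignedTransportAtTwoHalfDescentBaseIndexSelmer

end
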